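import Summits.QuantumFields.YangMills.Theorems.UnitScaleTiltProp7PoissonGradientDecayAllMembers
import Summits.QuantumFields.YangMills.Theorems.UnitScaleTiltProp7OneFormGreenBlockDivergenceKFree
import HarnessLib

/-!
# Route `UnitScaleTilt`, crux K1 «MinimiserStabilityRegPr» (stmt-QuantumFields-19200), EX face, norm_G ∕ h133 road — N6 FILE D letter (dκ) = (Db), **ROOM-FREE EDITIONS (R-D1):
# THE DECAYED COVARIANT-DIVERGENCE ROW OF `G₀` ON A BLOCK-SUPPORTED SOURCE AT EVERY MEMBER — the no-wrap antecedent `hroom : 2(12·L^{K−n} + 5) ≤ sitesPerDir 0` DELETED from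
# ✓`Prop7OneFormGreenBlockDivergence.componentGradient_decay_of_rows` ∕ ✓`norm_symm_DstarL2_GT_le_of_blockSupport` ((Db) member) ∕ ✓`Prop7OneFormGreenBlockDivergenceKFree.divergence_GT_DeltaEtaSlot_kfree`
# ((Db)-K), SAME constants, by swapping their ONE room-consuming supplier px21 ✓`Prop7PoissonGradientDecay.gradient_decay_of_decay'` for px5 g15's R1
# ✓`Prop7PoissonGradientDecayAllMembers.gradient_decay_of_decay_allMembers'` (T1-κ READ ON THE `L³`-FOLD COVER, which has room — a cover *reading*, constant unchanged, print p.399 L1–3).**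
# (width seat `ym3-torus-px21` g16; GENERATED, NOT HAND-TYPED: `gen/gen_rd.py` slices the three TREE theorems and applies per theorem exactly (a) rename `X ↦ X_allMembers`, (b) delete the ONE
# binder `(hroom : …)`, (c) swap the ONE supplier token and drop the ONE `hroom` argument — every edit asserted to match once; variable blocks copied VERBATIM ⇒ explicit-argument order IDENTICAL
# to the tree's minus `hroom`.)

Cell `ym3-torus` (HUMAN RULING D-0037; rung R3 = SU(2) YM₃ on T³ — NOT d = 4, NOT infinite volume, NOT a mass gap, NOT Clay).  THEOREMS ONLY (0 `def`, 0 `sorry`);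
`--supports stmt-QuantumFields-19200 --as helper`; count-neutral.

WHAT IS PROVED (ns `Summit.QuantumFields.YangMills.Theorems.Prop7OneFormGreenBlockDivergenceAllMembers`).
* §1 ★★ `componentGradient_decay_of_rows_allMembers` — ✓`componentGradient_decay_of_rows` minus `hroom` (over R1; §1's two row lemmas ✓`formComp_decay_of_val`, ✓`remainder_decay_of_rows` are
  IMPORTED, not re-typed).
* §2 ★★★ `norm_symm_DstarL2_GT_le_of_blockSupport_allMembers` — **(Db) AT EVERY MEMBER**: ✓`norm_symm_DstarL2_GT_le_of_blockSupport`'s statement with the `hroom` binder deleted, conclusion and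
  printed constant `C_D` BYTE-IDENTICAL.
* §3 ★★★ `divergence_GT_DeltaEtaSlot_kfree_allMembers` — **(Db)-K AT EVERY MEMBER**: ✓`divergence_GT_DeltaEtaSlot_kfree`'s statement with the `hroom` binder deleted, member-free `C_D⋆`
  BYTE-IDENTICAL; its decl-local `set_option maxHeartbeats 400000 in` INHERITED VERBATIM from the tree decl it re-runs (README class, disclosed there: fails 200k, passes 300k).
USE.  D3 ✓`hGblk_pi_of_blockLetters`' `hDb`, px16's GΠ-PKG(-R), px10's cone PART C `hDb`, px21 F1 (∇b)∕(∇0) and (D0) editions: swap one token, drop one argument∕conjunct.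
HYP-SAT (★★OWNER RULING №42): the tree's hypotheses minus the room (all inhabited as recorded there); conclusions explicit decayed rows; no `Prop` placeholder.
HONEST SCOPE.  Mechanical re-runs of landed proofs over R1; CONDITIONAL on the displayed letters; nothing of FILE D, `h133`, `norm_G`, the EX rows, EX, 19200 or the rung is proved here;
no summit is proved by a helper; the Yang–Mills mass gap is NOT proved.

References: T. Bałaban, CMP **99** (1985) 389–434 [Balaban1985BackgroundPropagators] ((3.8) p.392, Thm 3.1 (3.42)–(3.47) pp.397–399, (3.49) p.399, Thm 3.11 p.416, Thm 3.12 p.422);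
CMP **102** (1985) 277–309 [Balaban1985Variational] ((19) p.281, (134)–(135) p.298); CMP **96** (1984) 223–250 [Balaban1984PropagatorsII] (Lemma 2.1 pp.227–228).
-/

set_option autoImplicit false

noncomputable section

open scoped BigOperators Matrix.Norms.L2Operator InnerProductSpace ComplexConjugate

namespace Summit.QuantumFields.YangMills.Theorems.Prop7OneFormGreenBlockDivergenceAllMembers

open Literature.MathematicalPhysics.QuantumFieldTheory.Balaban1983to89
open Literature.MathematicalPhysics.QuantumFieldTheory.Balaban1983to89.T3ContinuumYM3Torus
open Literature.MathematicalPhysics.QuantumFieldTheory.Balaban1983to89.T3PrintedRegularMinimiser (RegPr)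
open T3SectALandauChart (formComp bgUnits covDerivFwdT covDivFormT eta eta_pos)
open B10Eq68TorusRegularity (covDerivT)
open B7Eq78Linearization (conjR conjR_apply conjR_sub conjR_smul_real)
open B7Prop1Explicit (U1)
open B4Sect5Torus (TSite)
open B9SectCLatticeCarrier (Bond)
open B9TorusCalculus (torusT torusT_apply torusT_symm_apply)
open B9Eq310Hermitian (deltaPrimeOp)
open B11Eq135Weitzenbock (curvOp)
open B9Eq311L2Pairing (WL2)
open B11Eq103H1Complex (BondL2K SiteL2K)
open B5Eq118OneStroke (iterBlockOf)
open B3Taylor310LocalRemainder (tdist_comm tdist_triangle)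
open Summit.QuantumFields.Balaban3D.Proofs.Run3Collar (tdist_shift_le)
open Summit.QuantumFields.YangMills.Theorems.Prop7SectET3Transport (periodsT3 siteEquiv bondEquiv)
open Summit.QuantumFields.YangMills.Theorems.Prop7SectET3HilbertLetters (W₂ frobEquiv toL2 toL2S DL2 DstarL2 covLapSite toL2_apply toL2_symm_apply toL2S_apply)
open Summit.QuantumFields.YangMills.Theorems.Prop7LandauDict (DL2_toL2S_eq_covDerivFwdT DstarL2_toL2_eq_covDivFormT)
open Summit.QuantumFields.YangMills.Theorems.Prop7OneFormAgmonLocal (deltaPrimeOp_congr_of_agree curvOp_congr_of_agree tdist_le_two_of_stencil)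
open Summit.QuantumFields.YangMills.Theorems.Prop7OneFormKatoForm (norm_local_remainder_le_of_regPr)
open Summit.QuantumFields.YangMills.Theorems.Prop7SectET3WilsonHessian (DeltaEta DeltaEtaSlot)
open Summit.QuantumFields.YangMills.Theorems.Prop7SectET3GaugeProjector (RS)
open Summit.QuantumFields.YangMills.Theorems.Prop7SectET3CurvedPropagators (laplaceA Qk GT PosOnto laplaceA_GT)
open Summit.QuantumFields.YangMills.Theorems.Prop7RieszTauFrobNorm (norm_frobEquiv_le norm_frobEquiv_symm_le)
open Summit.QuantumFields.YangMills.Theorems.Prop7OneFormGreenSupBound (norm_toL2_blockPiece_le)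
open Summit.QuantumFields.YangMills.Theorems.Prop7OneFormBlockDecayAll (blockDecay_allBlocks_of_letters eta_sq_exp_sub_one_sq_le)
open Summit.QuantumFields.YangMills.Theorems.Prop7OneFormRemainderDecay (norm_symm_apply_le_of_kernelRow_blockDecay)
open Summit.QuantumFields.YangMills.Theorems.Prop7OneFormDecayData (norm_le_mul_exp_neg_of_support)
open Summit.QuantumFields.YangMills.Theorems.Prop7CurvedMemberLocalGradient (exists_curved_localGradient)
open Summit.QuantumFields.YangMills.Theorems.AxialGaugeChartGlue (norm_bgOfCfg_axialT_sub_le)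
open Summit.QuantumFields.YangMills.Theorems.Prop7OneFormGreenBlockDivergenceLetters (norm_local_pair_le_of_decay blockL2Decay_GT_of_letters
  norm_word_le_of_kernelRow_blockDecay norm_symm_DstarL2_le_of_componentDecay)
open B15DeterminingSets (embIter)
open T3SectALandauChart (formComp bgUnits eta eta_pos)
open B11Eq103H1Complex (BondL2K)
open Summit.QuantumFields.YangMills.Theorems.Prop8Chart (emlIterU)
open Summit.QuantumFields.YangMills.Theorems.Prop7SectET3Transport (periodsT3 bondEquiv)
open Summit.QuantumFields.YangMills.Theorems.Prop7SectET3HilbertLetters (W₂ frobEquiv toL2 toL2S DL2 DstarL2)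
open Summit.QuantumFields.YangMills.Theorems.Prop7SectET3WilsonHessian (DeltaEtaSlot)
open Summit.QuantumFields.YangMills.Theorems.Prop7SectET3CurvedPropagators (laplaceA Qk GT PosOnto)
open Summit.QuantumFields.YangMills.Theorems.Prop7OneFormAgmonPhaseClass (hVconj_phaseClass_of_letters)
open Summit.QuantumFields.YangMills.Theorems.Prop7QkPenaltyKernelRowOfRegPr (hkQ_of_regPr)
open Summit.QuantumFields.YangMills.Theorems.Prop7QkAdjointSupRowOfRegPr (norm_Qk_le_of_regPr)
open Summit.QuantumFields.YangMills.Theorems.Prop7QkOntoOfRegPr (surjective_Qk_of_regPr)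
open Summit.QuantumFields.YangMills.Theorems.Prop7OneFormRemainderFloorOfLift (hVlow_abs_of_lift)
open Summit.QuantumFields.YangMills.Theorems.Prop7OneFormGreenSupBound (norm_symm_GT_apply_le_of_blockSupport)
open Summit.QuantumFields.YangMills.Theorems.Prop7OneFormGreenKFreeNumerics (sqrt_vol_mul_sqrt_mass_eq twoA₂_le_kfree thetaV_le_kfree hsmall_le_half rbudget_le theta_ge_half_of_budgets CV_abs_le)
open Summit.QuantumFields.YangMills.Theorems.Prop7OneFormGreenBlockDivergence (norm_symm_DstarL2_GT_le_of_blockSupport)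
open Summit.QuantumFields.YangMills.Theorems.Prop7OneFormGreenBlockDivergence (formComp_decay_of_val remainder_decay_of_rows)
open Summit.QuantumFields.YangMills.Theorems.Prop7OneFormGreenBlockDivergenceKFree (words_le_kfree CD_mono exp_mul_kappa_le)

/-! ## §1–§2 (Db) at every member (no room) -/

section MemberD

variable (F : T3Family) {n K : ℕ} (c₀ : ℝ) [Fact (0 < c₀)] (U₀ : GaugeField (F.P K) 0 (Matrix.specialUnitaryGroup (Fin 2) ℂ))
  {h : n ≤ K} {cB a : ℝ} [Fact (0 < cB)]

/-- ★★ **THE COMPONENTS' COVARIANT GRADIENTS DECAY** — R1 ✓`Prop7PoissonGradientDecayAllMembers.gradient_decay_of_decay_allMembers'` (px5 g15: T1-κ read on the `L³`-fold cover, NO no-wrap room) for `u_ν := toL2S(G₀X)_ν` (equation ✓`covLapSite_formComp_add_eq` at the slot of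
record) fed with the two lemmas above: `‖toL2⁻¹(D_{U₀}(toL2S (G₀X)_ν)) b‖ ≤ M(c_V, c_L + c_D + c_Q + c_S)·e^{−κ·d(B b₋, z)}`.
[cite: Balaban1985BackgroundPropagators, Thm 3.1 (3.42)–(3.44) pp.397–398; Balaban1985Variational, (19) p.281, (134)–(135) p.298] -/
theorem componentGradient_decay_of_rows_allMembers {ε₀ : ℝ} (hε₀ : 0 < ε₀) (hε₀1 : ε₀ ≤ 1) (hreg : RegPr F n K ε₀ U₀)
    (hp : PosOnto F n K h c₀ cB a (DeltaEtaSlot F n K c₀) U₀) (X : PBond (F.P K) 0 → Matrix (Fin 2) (Fin 2) ℂ) (z : Site (F.P K) (K - n))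
    {κ : ℝ} (hκ : 0 ≤ κ) {cV cL cD cQ cS : ℝ} (hcV : 0 ≤ cV) (hcL : 0 ≤ cL) (hcD : 0 ≤ cD) (hcQ : 0 ≤ cQ) (hcS : 0 ≤ cS)
    (hval : ∀ b : PBond (F.P K) 0, ‖((toL2 F K c₀).symm (GT F n K h c₀ cB a (DeltaEtaSlot F n K c₀) U₀ (toL2 F K c₀ X))) b‖ ≤ cV * Real.exp (-(κ * (Site.tdist (P := F.P K) (iterBlockOf (K - n) b.src) z : ℝ))))
    (hLoc : ∀ b : PBond (F.P K) 0, ‖(eta F n K)⁻¹ • (eta F n K)⁻¹ •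
        (deltaPrimeOp (torusT (F.P K) 0) (fun μ x => bgUnits F K U₀ ⟨x, μ⟩) 1 (formComp ((toL2 F K c₀).symm (GT F n K h c₀ cB a (DeltaEtaSlot F n K c₀) U₀ (toL2 F K c₀ X)))) b.dir b.src
          - curvOp (torusT (F.P K) 0) (fun μ x => bgUnits F K U₀ ⟨x, μ⟩) (formComp ((toL2 F K c₀).symm (GT F n K h c₀ cB a (DeltaEtaSlot F n K c₀) U₀ (toL2 F K c₀ X)))) b.dir b.src)‖ ≤ cL * Real.exp (-(κ * (Site.tdist (P := F.P K) (iterBlockOf (K - n) b.src) z : ℝ))))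
    (hDw : ∀ b : PBond (F.P K) 0, ‖(toL2 F K c₀).symm (DL2 F n K c₀ U₀ (DstarL2 F n K c₀ U₀ (toL2 F K c₀ ((toL2 F K c₀).symm (GT F n K h c₀ cB a (DeltaEtaSlot F n K c₀) U₀ (toL2 F K c₀ X)))) - RS F n K h c₀ cB U₀ (DstarL2 F n K c₀ U₀ (toL2 F K c₀ ((toL2 F K c₀).symm (GT F n K h c₀ cB a (DeltaEtaSlot F n K c₀) U₀ (toL2 F K c₀ X))))))) b‖ ≤ cD * Real.exp (-(κ * (Site.tdist (P := F.P K) (iterBlockOf (K - n) b.src) z : ℝ))))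
    (hQw : ∀ b : PBond (F.P K) 0, ‖(toL2 F K c₀).symm (LinearMap.adjoint (Qk F n K h c₀ cB U₀) (((a : ℝ) : ℂ) • Qk F n K h c₀ cB U₀ (toL2 F K c₀ ((toL2 F K c₀).symm (GT F n K h c₀ cB a (DeltaEtaSlot F n K c₀) U₀ (toL2 F K c₀ X)))))) b‖ ≤ cQ * Real.exp (-(κ * (Site.tdist (P := F.P K) (iterBlockOf (K - n) b.src) z : ℝ))))
    (hSrc : ∀ b : PBond (F.P K) 0, ‖X b‖ ≤ cS * Real.exp (-(κ * (Site.tdist (P := F.P K) (iterBlockOf (K - n) b.src) z : ℝ))))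
    (hsmall : exists_curved_localGradient.choose * ((48 * ε₀) * (6 * Real.sqrt 2 * Real.sqrt 10 + 6 * Real.sqrt 2)) * Real.exp (51 * κ) ≤ 1 / 2)
    (ν : Fin (F.P K).d) (b : PBond (F.P K) 0) :
    ‖(toL2 F K c₀).symm (DL2 F n K c₀ U₀ (toL2S F K c₀ (formComp ((toL2 F K c₀).symm (GT F n K h c₀ cB a (DeltaEtaSlot F n K c₀) U₀ (toL2 F K c₀ X))) ν))) b‖
      ≤ (2 * ((exists_curved_localGradient.choose * (((Real.sqrt 2 * cV) * Real.exp (51 * κ)) * (2 + 2 * Real.sqrt 2 * (4 * ε₀ * (3 + 2457 * norm_bgOfCfg_axialT_sub_le.choose)) + (24 * Real.sqrt 10 + 48) * (48 * ε₀) ^ 2) + (Real.sqrt 2 * (cL + cD + cQ + cS)) * Real.exp (51 * κ)) + 2 * Real.sqrt 2 * (48 * ε₀) * ((Real.sqrt 2 * cV) * Real.exp (51 * κ))))) * Real.exp (-(κ * (Site.tdist (P := F.P K) (iterBlockOf (K - n) b.src) z : ℝ))) := by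
  have hXY : laplaceA F n K h c₀ cB a (DeltaEtaSlot F n K c₀) U₀ (toL2 F K c₀ ((toL2 F K c₀).symm (GT F n K h c₀ cB a (DeltaEtaSlot F n K c₀) U₀ (toL2 F K c₀ X)))) = toL2 F K c₀ X := by
    rw [LinearEquiv.apply_symm_apply]; exact laplaceA_GT hp _
  exact Prop7PoissonGradientDecayAllMembers.gradient_decay_of_decay_allMembers' F n K hε₀ hε₀1 U₀ hreg c₀ _ _
    (Prop7OneFormGradientSup.covLapSite_formComp_add_eq F h c₀ cB a (DeltaEtaSlot F n K c₀) U₀ _ X hXY ν) z hκ (by positivity) (by positivity)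
    (formComp_decay_of_val F c₀ _ z κ hval ν) (remainder_decay_of_rows F c₀ U₀ _ X z κ hLoc hDw hQw hSrc ν) hsmall b


/-- ★★★ **(dκ) «N5-blk»: THE DECAYED COVARIANT-DIVERGENCE ROW OF `G₀` ON A BLOCK-SUPPORTED SOURCE** ([Balaban1985BackgroundPropagators] Thm 3.1 (3.42)₂∕(3.43) for the member's `G₀` at
the slot of record, divergence∕decay edition).  DISPLAYED: `RegPr F n K ε₀ U₀` with `0 < ε₀ ≤ 1`; `PosOnto` at `Δx := DeltaEtaSlot`; the one-form Agmon letters (γ) `hco`, (C_V) `hVlow`,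
(θ_V-class) `hVconj`, the window `0 < Θ` (`Θ = (1−ε)γ − εC_V − 3r²e^{2r}(1+1∕ε) − θ_V`); the kernel rows `hkD` (`D(1−R_S)D*`, the EX row `h349`'s member text) and `hkQ` (`Q_k†(a•Q_k)`) at a rate
`μ′ > r`; THE DECAYED VALUE ROW `hval` (`‖toL2⁻¹(G₀(toL2 X)) b‖ ≤ s·A_V·e^{−κ₁·d(B b₋, z)}`, `κ₁ := min r (1∕4)∕2` — px16 ✓`Prop7OneFormGreenSupBound.norm_symm_GT_apply_le_of_blockSupport`'s
CONCLUSION, its constant a free real letter `A_V` — no sign displayed, `0 ≤ s·A_V` is read off the row itself); (NO no-wrap room — R1 reads T1-κ on the cover) the gradient margin `C_g·(48ε₀(6√2√10 + 6√2))·e^{51κ₁} ≤ ½`.  THEN for every bond field `X` supported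
on the bonds of the block `z` with `‖X b‖ ≤ s` and every site `x`:
`‖(toL2S⁻¹(D*_{U₀}(G₀(toL2 X))))(x)‖ ≤ s·C_D·e^{−κ₁·tdist(B x, z)}`, `C_D = 3·e^{4κ₁}·M`, `M = 2·(C_g·(√2A_V e^{51κ₁}·c(ε₀) + √2A_q·e^{51κ₁}) + 2√2·48ε₀·√2A_V e^{51κ₁})`,
`A_q = 32ε₀·A_V e^{5κ₁} + (C_kD + C_kQ)·√(dℓ^d∕c₀)·D₁·(2(1+1∕(μ′−r)))³ + 1` (as a sum of the two words), `D₁ = e^{6r}√(2c₀dℓ^d)∕Θ`.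
PROOF = §1 with the rows: VALUE `hval`; local pair part 2 ✓`norm_local_pair_le_of_decay` (`32ε₀·sA_V·e^{5κ₁}`); (D)∕(Q) words part 2 ✓`norm_word_le_of_kernelRow_blockDecay` at rate `r ≥ κ₁` over
✓`blockL2Decay_GT_of_letters`; source by support (✓`norm_le_mul_exp_neg_of_support`); then part 2 ✓`norm_symm_DstarL2_le_of_componentDecay`.
K-BOOKKEEPING (for the knitter's numerics, cf. px16's `…OneFormGreenKFreeNumerics`): every `(L^d)^{K−n}` above stands next to `C_kD`, `C_kQ` (`ℓ⁻³`-class, chair №13) or inside `√(2c₀dℓ^d)`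
(`= √6` at the pin `c₀ = ℓ⁻³`).  CONDITIONAL on every displayed letter; nothing of FILE D, `norm_G`, `h133`, the EX rows, EX or the crux is proved here.
[cite: Balaban1985BackgroundPropagators, (3.8) p.392, Thm 3.1 (3.42)–(3.44) pp.397–398, (3.46) p.398, (3.49) p.399, Thm 3.12 p.422; Balaban1985Variational, (19) p.281, (134)–(135) p.298] -/
theorem norm_symm_DstarL2_GT_le_of_blockSupport_allMembers (hnK : n ≤ K) {ε₀ : ℝ} (hε₀ : 0 < ε₀) (hε₀1 : ε₀ ≤ 1) (hreg : RegPr F n K ε₀ U₀)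
    (hp : PosOnto F n K h c₀ cB a (DeltaEtaSlot F n K c₀) U₀)
    {r : ℝ} (hr : 0 < r) {γ CV θV ε : ℝ} (hε : 0 < ε) (hε1 : ε ≤ 1)
    (hco : ∀ v : BondL2K ℂ 3 (periodsT3 F K) c₀ W₂, γ * ‖v‖ ^ 2 ≤ RCLike.re ⟪v, laplaceA F n K h c₀ cB a (DeltaEtaSlot F n K c₀) U₀ v⟫_ℂ)
    (hVlow : ∀ X : PBond (F.P K) 0 → Matrix (Fin 2) (Fin 2) ℂ,
      -(CV * ‖toL2 F K c₀ X‖ ^ 2) ≤ RCLike.re ⟪toL2 F K c₀ X, laplaceA F n K h c₀ cB a (DeltaEtaSlot F n K c₀) U₀ (toL2 F K c₀ X)⟫_ℂ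
        - ∑ μ : Fin (F.P K).d, ‖DL2 F n K c₀ U₀ (toL2S F K c₀ (formComp X μ))‖ ^ 2)
    (hVconj : ∀ φ : Site (F.P K) 0 → ℝ, (∀ x x' : Site (F.P K) 0, |φ x - φ x'| ≤ r * eta F n K * (Site.tdist x x' : ℝ)) →
      ∀ X : PBond (F.P K) 0 → Matrix (Fin 2) (Fin 2) ℂ,
      RCLike.re ⟪toL2 F K c₀ X, laplaceA F n K h c₀ cB a (DeltaEtaSlot F n K c₀) U₀ (toL2 F K c₀ X)⟫_ℂ
          - (∑ μ : Fin (F.P K).d, ‖DL2 F n K c₀ U₀ (toL2S F K c₀ (formComp X μ))‖ ^ 2) - θV * ‖toL2 F K c₀ X‖ ^ 2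
        ≤ RCLike.re ⟪toL2 F K c₀ (fun b => Real.exp (φ b.src) • X b), laplaceA F n K h c₀ cB a (DeltaEtaSlot F n K c₀) U₀ (toL2 F K c₀ (fun b => (Real.exp (φ b.src))⁻¹ • X b))⟫_ℂ
          - RCLike.re (∑ μ : Fin (F.P K).d, ⟪DL2 F n K c₀ U₀ (toL2S F K c₀ (formComp (fun b => Real.exp (φ b.src) • X b) μ)),
              DL2 F n K c₀ U₀ (toL2S F K c₀ (formComp (fun b => (Real.exp (φ b.src))⁻¹ • X b) μ))⟫_ℂ))
    (hΘ : 0 < ((1 - ε) * γ - ε * CV - 3 * (r ^ 2 * Real.exp (2 * r)) * (1 + 1 / ε) - θV))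
    {CkD CkQ μ' : ℝ} (hCkD : 0 ≤ CkD) (hCkQ : 0 ≤ CkQ) (hrμ : r < μ')
    (hkD : ∀ (b : PBond (F.P K) 0) (Z : Matrix (Fin 2) (Fin 2) ℂ) (bd : PBond (F.P K) 0),
      ‖(toL2 F K c₀).symm (DL2 F n K c₀ U₀ (DstarL2 F n K c₀ U₀ (toL2 F K c₀ (Pi.single b Z))
          - RS F n K h c₀ cB U₀ (DstarL2 F n K c₀ U₀ (toL2 F K c₀ (Pi.single b Z))))) bd‖
        ≤ CkD * Real.exp (-(μ' * (Site.tdist (P := F.P K) (iterBlockOf (K - n) b.src) (iterBlockOf (K - n) bd.src) : ℝ))) * ‖Z‖)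
    (hkQ : ∀ (b : PBond (F.P K) 0) (Z : Matrix (Fin 2) (Fin 2) ℂ) (bd : PBond (F.P K) 0),
      ‖(toL2 F K c₀).symm (LinearMap.adjoint (Qk F n K h c₀ cB U₀) (((a : ℝ) : ℂ) • Qk F n K h c₀ cB U₀ (toL2 F K c₀ (Pi.single b Z)))) bd‖
        ≤ CkQ * Real.exp (-(μ' * (Site.tdist (P := F.P K) (iterBlockOf (K - n) b.src) (iterBlockOf (K - n) bd.src) : ℝ))) * ‖Z‖)
    (X : PBond (F.P K) 0 → Matrix (Fin 2) (Fin 2) ℂ) (z : Site (F.P K) (K - n)) (hXz : ∀ b, X b ≠ 0 → iterBlockOf (K - n) b.src = z)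
    {s : ℝ} (hs : 0 ≤ s) (hX : ∀ b, ‖X b‖ ≤ s)
    {AV : ℝ}
    (hval : ∀ bd : PBond (F.P K) 0, ‖((toL2 F K c₀).symm (GT F n K h c₀ cB a (DeltaEtaSlot F n K c₀) U₀ (toL2 F K c₀ X))) bd‖ ≤ s * AV * Real.exp (-((min r (1 / 4) / 2) * (Site.tdist (P := F.P K) (iterBlockOf (K - n) bd.src) z : ℝ))))
    (hsmall : exists_curved_localGradient.choose * ((48 * ε₀) * (6 * Real.sqrt 2 * Real.sqrt 10 + 6 * Real.sqrt 2)) * Real.exp (51 * (min r (1 / 4) / 2)) ≤ 1 / 2)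
    (x : Site (F.P K) 0) :
    ‖(toL2S F K c₀).symm (DstarL2 F n K c₀ U₀ (GT F n K h c₀ cB a (DeltaEtaSlot F n K c₀) U₀ (toL2 F K c₀ X))) x‖
      ≤ s * (3 * (Real.exp (4 * (min r (1 / 4) / 2)) * (2 * ((exists_curved_localGradient.choose * (((Real.sqrt 2 * AV) * Real.exp (51 * (min r (1 / 4) / 2))) * (2 + 2 * Real.sqrt 2 * (4 * ε₀ * (3 + 2457 * norm_bgOfCfg_axialT_sub_le.choose)) + (24 * Real.sqrt 10 + 48) * (48 * ε₀) ^ 2) + (Real.sqrt 2 * ((32 * ε₀ * (AV * Real.exp (5 * (min r (1 / 4) / 2)))) + (CkD * Real.sqrt ((((F.P K).d : ℝ) * ((((F.P K).L : ℝ) ^ (F.P K).d) ^ (K - n))) / c₀) * (Real.exp (6 * r) * Real.sqrt (2 * c₀ * (((F.P K).d : ℝ) * ((((F.P K).L : ℝ) ^ (F.P K).d) ^ (K - n)))) / ((1 - ε) * γ - ε * CV - 3 * (r ^ 2 * Real.exp (2 * r)) * (1 + 1 / ε) - θV)) * (2 * (1 + 1 / (μ' - r))) ^ 3) + (CkQ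 * Real.sqrt ((((F.P K).d : ℝ) * ((((F.P K).L : ℝ) ^ (F.P K).d) ^ (K - n))) / c₀) * (Real.exp (6 * r) * Real.sqrt (2 * c₀ * (((F.P K).d : ℝ) * ((((F.P K).L : ℝ) ^ (F.P K).d) ^ (K - n)))) / ((1 - ε) * γ - ε * CV - 3 * (r ^ 2 * Real.exp (2 * r)) * (1 + 1 / ε) - θV)) * (2 * (1 + 1 / (μ' - r))) ^ 3) + 1)) * Real.exp (51 * (min r (1 / 4) / 2))) + 2 * Real.sqrt 2 * (48 * ε₀) * ((Real.sqrt 2 * AV) * Real.exp (51 * (min r (1 / 4) / 2)))))))) * Real.exp (-((min r (1 / 4) / 2) * (Site.tdist (P := F.P K) (iterBlockOf (K - n) x) z : ℝ))) := by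
  have hc₀ : 0 < c₀ := Fact.out
  have hk1 : 0 < (min r (1 / 4) / 2) := by have := lt_min hr (by norm_num : (0 : ℝ) < 1 / 4); positivity
  have hk1r : (min r (1 / 4) / 2) ≤ r := by have := min_le_left r (1 / 4); linarith
  have hD₁0 : 0 ≤ (Real.exp (6 * r) * Real.sqrt (2 * c₀ * (((F.P K).d : ℝ) * ((((F.P K).L : ℝ) ^ (F.P K).d) ^ (K - n)))) / ((1 - ε) * γ - ε * CV - 3 * (r ^ 2 * Real.exp (2 * r)) * (1 + 1 / ε) - θV)) := div_nonneg (by positivity) hΘ.le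
  have hS0 : 0 ≤ (2 * (1 + 1 / (μ' - r))) ^ 3 := by
    have : 0 < μ' - r := by linarith
    positivity
  -- rate `r` rows read at rate `κ₁ ≤ r`
  have hEr : ∀ b : PBond (F.P K) 0, Real.exp (-(r * (Site.tdist (P := F.P K) (iterBlockOf (K - n) b.src) z : ℝ))) ≤ Real.exp (-((min r (1 / 4) / 2) * (Site.tdist (P := F.P K) (iterBlockOf (K - n) b.src) z : ℝ))) := fun b =>
    Real.exp_le_exp.2 (by nlinarith [Nat.cast_nonneg (α := ℝ) (Site.tdist (P := F.P K) (iterBlockOf (K - n) b.src) z)])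
  -- VALUE
  have hWd : ∀ b : PBond (F.P K) 0, ‖((toL2 F K c₀).symm (GT F n K h c₀ cB a (DeltaEtaSlot F n K c₀) U₀ (toL2 F K c₀ X))) b‖ ≤ (s * AV) * Real.exp (-((min r (1 / 4) / 2) * (Site.tdist (P := F.P K) (iterBlockOf (K - n) b.src) z : ℝ))) := fun b => hval b
  -- `0 ≤ s·A_V` is READ OFF the value row at one bond (no sign hypothesis on `A_V` displayed)
  have hsAV : 0 ≤ s * AV := by
    have hb := hval ⟨x, ⟨0, by rw [T3Family.P_d]; norm_num⟩⟩
    have hE : 0 < Real.exp (-((min r (1 / 4) / 2) * (Site.tdist (P := F.P K) (iterBlockOf (K - n) (⟨x, ⟨0, by rw [T3Family.P_d]; norm_num⟩⟩ : PBond (F.P K) 0).src) z : ℝ))) :=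
      Real.exp_pos _
    have h0 : 0 * Real.exp (-((min r (1 / 4) / 2) * (Site.tdist (P := F.P K) (iterBlockOf (K - n) (⟨x, ⟨0, by rw [T3Family.P_d]; norm_num⟩⟩ : PBond (F.P K) 0).src) z : ℝ)))
        ≤ (s * AV) * Real.exp (-((min r (1 / 4) / 2) * (Site.tdist (P := F.P K) (iterBlockOf (K - n) (⟨x, ⟨0, by rw [T3Family.P_d]; norm_num⟩⟩ : PBond (F.P K) 0).src) z : ℝ))) := by
      rw [zero_mul]; exact (norm_nonneg _).trans hb
    exact le_of_mul_le_mul_right h0 hE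
  have hWeq : toL2 F K c₀ ((toL2 F K c₀).symm (GT F n K h c₀ cB a (DeltaEtaSlot F n K c₀) U₀ (toL2 F K c₀ X))) = GT F n K h c₀ cB a (DeltaEtaSlot F n K c₀) U₀ (toL2 F K c₀ X) := LinearEquiv.apply_symm_apply _ _
  -- the block-`L²` decay and the two words
  have hD := blockL2Decay_GT_of_letters F c₀ U₀ hnK hp hr hε hε1 hco hVlow hVconj hΘ X z hXz hs hX
  have hkD' : ∀ (b : PBond (F.P K) 0) (Z : Matrix (Fin 2) (Fin 2) ℂ) (bd : PBond (F.P K) 0),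
      ‖(toL2 F K c₀).symm ((DL2 F n K c₀ U₀ ∘ₗ (DstarL2 F n K c₀ U₀ - RS F n K h c₀ cB U₀ ∘ₗ DstarL2 F n K c₀ U₀)) (toL2 F K c₀ (Pi.single b Z))) bd‖
        ≤ CkD * Real.exp (-(μ' * (Site.tdist (P := F.P K) (iterBlockOf (K - n) b.src) (iterBlockOf (K - n) bd.src) : ℝ))) * ‖Z‖ := fun b Z bd => hkD b Z bd
  have hkQ' : ∀ (b : PBond (F.P K) 0) (Z : Matrix (Fin 2) (Fin 2) ℂ) (bd : PBond (F.P K) 0),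
      ‖(toL2 F K c₀).symm ((LinearMap.adjoint (Qk F n K h c₀ cB U₀) ∘ₗ (((a : ℝ) : ℂ) • Qk F n K h c₀ cB U₀)) (toL2 F K c₀ (Pi.single b Z))) bd‖
        ≤ CkQ * Real.exp (-(μ' * (Site.tdist (P := F.P K) (iterBlockOf (K - n) b.src) (iterBlockOf (K - n) bd.src) : ℝ))) * ‖Z‖ := fun b Z bd => hkQ b Z bd
  have hDword : ∀ bd : PBond (F.P K) 0, ‖(toL2 F K c₀).symm (DL2 F n K c₀ U₀ (DstarL2 F n K c₀ U₀ (toL2 F K c₀ ((toL2 F K c₀).symm (GT F n K h c₀ cB a (DeltaEtaSlot F n K c₀) U₀ (toL2 F K c₀ X)))) - RS F n K h c₀ cB U₀ (DstarL2 F n K c₀ U₀ (toL2 F K c₀ ((toL2 F K c₀).symm (GT F n K h c₀ cB a (DeltaEtaSlot F n K c₀) U₀ (toL2 F K c₀ X))))))) bd‖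
      ≤ (CkD * Real.sqrt ((((F.P K).d : ℝ) * ((((F.P K).L : ℝ) ^ (F.P K).d) ^ (K - n))) / c₀) * ((Real.exp (6 * r) * Real.sqrt (2 * c₀ * (((F.P K).d : ℝ) * ((((F.P K).L : ℝ) ^ (F.P K).d) ^ (K - n)))) / ((1 - ε) * γ - ε * CV - 3 * (r ^ 2 * Real.exp (2 * r)) * (1 + 1 / ε) - θV)) * s) * (2 * (1 + 1 / (μ' - r))) ^ 3) * Real.exp (-((min r (1 / 4) / 2) * (Site.tdist (P := F.P K) (iterBlockOf (K - n) bd.src) z : ℝ))) := by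
    intro bd
    have h1 := norm_word_le_of_kernelRow_blockDecay F c₀ _ hCkD hkD' _ z (mul_nonneg hD₁0 hs) hr.le hrμ hD bd
    rw [hWeq]
    exact h1.trans (mul_le_mul_of_nonneg_left (hEr bd) (mul_nonneg (mul_nonneg (mul_nonneg hCkD (Real.sqrt_nonneg _)) (mul_nonneg hD₁0 hs)) hS0))
  have hQword : ∀ bd : PBond (F.P K) 0, ‖(toL2 F K c₀).symm (LinearMap.adjoint (Qk F n K h c₀ cB U₀) (((a : ℝ) : ℂ) • Qk F n K h c₀ cB U₀ (toL2 F K c₀ ((toL2 F K c₀).symm (GT F n K h c₀ cB a (DeltaEtaSlot F n K c₀) U₀ (toL2 F K c₀ X)))))) bd‖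
      ≤ (CkQ * Real.sqrt ((((F.P K).d : ℝ) * ((((F.P K).L : ℝ) ^ (F.P K).d) ^ (K - n))) / c₀) * ((Real.exp (6 * r) * Real.sqrt (2 * c₀ * (((F.P K).d : ℝ) * ((((F.P K).L : ℝ) ^ (F.P K).d) ^ (K - n)))) / ((1 - ε) * γ - ε * CV - 3 * (r ^ 2 * Real.exp (2 * r)) * (1 + 1 / ε) - θV)) * s) * (2 * (1 + 1 / (μ' - r))) ^ 3) * Real.exp (-((min r (1 / 4) / 2) * (Site.tdist (P := F.P K) (iterBlockOf (K - n) bd.src) z : ℝ))) := by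
    intro bd
    have h1 := norm_word_le_of_kernelRow_blockDecay F c₀ _ hCkQ hkQ' _ z (mul_nonneg hD₁0 hs) hr.le hrμ hD bd
    rw [hWeq]
    exact h1.trans (mul_le_mul_of_nonneg_left (hEr bd) (mul_nonneg (mul_nonneg (mul_nonneg hCkQ (Real.sqrt_nonneg _)) (mul_nonneg hD₁0 hs)) hS0))
  -- LOCAL pair and SOURCE
  have hLoc := norm_local_pair_le_of_decay F U₀ hreg ((toL2 F K c₀).symm (GT F n K h c₀ cB a (DeltaEtaSlot F n K c₀) U₀ (toL2 F K c₀ X))) z hk1.le hsAV hWd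
  have hSrc : ∀ b : PBond (F.P K) 0, ‖X b‖ ≤ s * Real.exp (-((min r (1 / 4) / 2) * (Site.tdist (P := F.P K) (iterBlockOf (K - n) b.src) z : ℝ))) := fun b =>
    norm_le_mul_exp_neg_of_support X (fun b => (Site.tdist (P := F.P K) (iterBlockOf (K - n) b.src) z : ℝ)) (min r (1 / 4) / 2) hX
      (fun b hb => by rw [hXz b hb]; exact_mod_cast B3Taylor310LocalRemainder.tdist_self z) b
  -- the components' gradients, then the divergence
  have hgrad := componentGradient_decay_of_rows_allMembers F c₀ U₀ (h := h) (cB := cB) (a := a) hε₀ hε₀1 hreg hp X z hk1.le hsAV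
    (mul_nonneg (by positivity) (mul_nonneg hsAV (Real.exp_pos _).le) : 0 ≤ 32 * ε₀ * ((s * AV) * Real.exp (5 * (min r (1 / 4) / 2))))
    (mul_nonneg (mul_nonneg (mul_nonneg hCkD (Real.sqrt_nonneg _)) (mul_nonneg hD₁0 hs)) hS0)
    (mul_nonneg (mul_nonneg (mul_nonneg hCkQ (Real.sqrt_nonneg _)) (mul_nonneg hD₁0 hs)) hS0) hs
    hWd (fun b => (hLoc b).trans_eq (by ring)) hDword hQword hSrc hsmall
  have hM0 : 0 ≤ (2 * ((exists_curved_localGradient.choose * (((Real.sqrt 2 * (s * AV)) * Real.exp (51 * (min r (1 / 4) / 2))) * (2 + 2 * Real.sqrt 2 * (4 * ε₀ * (3 + 2457 * norm_bgOfCfg_axialT_sub_le.choose)) + (24 * Real.sqrt 10 + 48) * (48 * ε₀) ^ 2) + (Real.sqrt 2 * ((32 * ε₀ * ((s * AV) * Real.exp (5 * (min r (1 / 4) / 2)))) + (CkD * Real.sqrt ((((F.P K).d : ℝ) * ((((F.P K).L : ℝ) ^ (F.P K).d) ^ (K - n))) / c₀) * ((Real.exp (6 * r) * Real.sqrt (2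 * c₀ * (((F.P K).d : ℝ) * ((((F.P K).L : ℝ) ^ (F.P K).d) ^ (K - n)))) / ((1 - ε) * γ - ε * CV - 3 * (r ^ 2 * Real.exp (2 * r)) * (1 + 1 / ε) - θV)) * s) * (2 * (1 + 1 / (μ' - r))) ^ 3) + (CkQ * Real.sqrt ((((F.P K).d : ℝ) * ((((F.P K).L : ℝ) ^ (F.P K).d) ^ (K - n))) / c₀) * ((Real.exp (6 * r) * Real.sqrt (2 * c₀ * (((F.P K).d : ℝ) * ((((F.P K).L : ℝ) ^ (F.P K).d) ^ (K - n)))) / ((1 - ε) * γ - ε * CV - 3 * (r ^ 2 * Real.exp (2 * r)) * (1 + 1 / ε) - θV)) * s) * (2 * (1 + 1 / (μ' - r))) ^ 3) + s)) * Real.exp (51 * (min r (1 / 4) / 2))) + 2 * Real.sqrt 2 * (48 * ε₀) * ((Real.sqrt 2 * (s * AV)) * Real.exp (51 * (min r (1 / 4) / 2)))))) := by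
    have hCg := exists_curved_localGradient.choose_spec.1
    have hC := norm_bgOfCfg_axialT_sub_le.choose_spec.1
    have h1 : 0 ≤ ((32 * ε₀ * ((s * AV) * Real.exp (5 * (min r (1 / 4) / 2)))) + (CkD * Real.sqrt ((((F.P K).d : ℝ) * ((((F.P K).L : ℝ) ^ (F.P K).d) ^ (K - n))) / c₀) * ((Real.exp (6 * r) * Real.sqrt (2 * c₀ * (((F.P K).d : ℝ) * ((((F.P K).L : ℝ) ^ (F.P K).d) ^ (K - n)))) / ((1 - ε) * γ - ε * CV - 3 * (r ^ 2 * Real.exp (2 * r)) * (1 + 1 / ε) - θV)) * s) * (2 * (1 + 1 / (μ' - r))) ^ 3) + (CkQ * Real.sqrt ((((F.P K).d : ℝ) * ((((F.P K).L : ℝ) ^ (F.P K).d) ^ (K - n))) / c₀) * ((Real.exp (6 * r) * Real.sqrt (2 * c₀ * (((F.P K).d : ℝ) * ((((F.P K).L : ℝ) ^ (F.P K).d) ^ (K - n)))) / ((1 - ε) * γ - ε * CV - 3 * (r ^ 2 * Real.exp (2 * r)) * (1 + 1 / ε) - θV)) * s) * (2 * (1 + 1 / (μ' - r))) ^ 3)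 + s) := by
      refine add_nonneg (add_nonneg (add_nonneg (mul_nonneg (by positivity) (mul_nonneg hsAV (Real.exp_pos _).le)) ?_) ?_) hs
      · exact mul_nonneg (mul_nonneg (mul_nonneg hCkD (Real.sqrt_nonneg _)) (mul_nonneg hD₁0 hs)) hS0
      · exact mul_nonneg (mul_nonneg (mul_nonneg hCkQ (Real.sqrt_nonneg _)) (mul_nonneg hD₁0 hs)) hS0
    have hcε : 0 ≤ (2 + 2 * Real.sqrt 2 * (4 * ε₀ * (3 + 2457 * norm_bgOfCfg_axialT_sub_le.choose)) + (24 * Real.sqrt 10 + 48) * (48 * ε₀) ^ 2) := by positivity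
    have hA : 0 ≤ (Real.sqrt 2 * (s * AV)) * Real.exp (51 * (min r (1 / 4) / 2)) := mul_nonneg (mul_nonneg (Real.sqrt_nonneg _) hsAV) (Real.exp_pos _).le
    exact mul_nonneg (by norm_num) (add_nonneg (mul_nonneg hCg (add_nonneg (mul_nonneg hA hcε) (mul_nonneg (mul_nonneg (Real.sqrt_nonneg _) h1) (Real.exp_pos _).le)))
      (mul_nonneg (by positivity) hA))
  have hfin := norm_symm_DstarL2_le_of_componentDecay F c₀ U₀ ((toL2 F K c₀).symm (GT F n K h c₀ cB a (DeltaEtaSlot F n K c₀) U₀ (toL2 F K c₀ X))) z hk1.le hM0 hgrad x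
  rw [hWeq] at hfin
  refine hfin.trans (le_of_eq ?_)
  ring

end MemberD

/-! ## §3 (Db)-K at every member (no room) -/

section KFree

variable (F : T3Family) {n K : ℕ} (h : n ≤ K) (c₀ cB : ℝ) [Fact (0 < c₀)] [Fact (0 < cB)]

set_option maxHeartbeats 400000 in
/-- ★★★ **(dκ)-K: THE DECAYED COVARIANT-DIVERGENCE ROW OF `G₀` ON A BLOCK-SUPPORTED SOURCE, UNDER `Lift`, WITH A MEMBER-FREE CONSTANT** — ✓`norm_symm_DstarL2_GT_le_of_blockSupport`
((dκ), the (Db) letter of ★p1 g27's N6 FILE D3) with every N4-§2 letter FED as in px16 ✓`blockColumn_GT_DeltaEtaSlot_kfree` (its hypotheses VERBATIM: `n < K`; `RegPr` + the three `ε₀` windows;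
`Lift`; the coupling window `0 ≤ a ≤ a₁(c₀∕cB)ℓ³`; (γ) `hco`, `0 < γ`; `hk_D` in px10's `C_K·ℓ⁻³·e^{−δ_K·d}` currency; the budgets `r ≤ ¼`, `r ≤ δ_K∕2`, `ε ≤ ⅛`, `ε·C_V¹ ≤ γ∕8`, `r ≤ γε∕48`,
`r·T(a₁,C_K,δ_K) ≤ γ∕16`, `10⁵ε₀ ≤ γ∕16`), the decayed VALUE row by px16 ✓`norm_symm_GT_apply_le_of_blockSupport` fed the same way, PLUS the K-FREE gradient margin (NO no-wrap room — R1)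
`C_g·(48ε₀(6√2√10 + 6√2))·e^{51∕8} ≤ ½` (`κ₁ ≤ ⅛`).  THEN the (Db) TEXT with the MEMBER-FREE constant `C_D⋆(γ, C_K, δ_K, a₁, r, ε₀; C_g, C)` printed below (no `ℓ`, `c₀`, `cB`, `a`, `K`):
numerics §1 (`A_V ≤ ½·C_G` by ✓`twoA₂_le_kfree`, the two words by `words_le_kfree`, `e^{cκ₁} ≤ e^{c∕8}`) through `CD_mono`.  CONDITIONAL on (γ) `hco`, `hk_D`, `Lift`, the budgets, the margin; nothing of FILE D ∕ `h133` ∕ `norm_G` ∕ EX ∕ the crux is proved here.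
[cite: Balaban1985BackgroundPropagators, (3.8) p.392, Thm 3.1 (3.42)–(3.47) pp.397–399, (3.49) p.399, Thm 3.11 p.416, Thm 3.12 p.422; Balaban1985Variational, (134)–(135) p.298] -/
theorem divergence_GT_DeltaEtaSlot_kfree_allMembers (hnK : n < K) {ε₀ : ℝ} (hε₀ : 0 < ε₀) (hWε : 10 ^ 12 * (F.L : ℝ) ^ 3 * ε₀ ≤ 1)
    (hε10 : 10 ^ 10 * (F.L : ℝ) ^ 6 * ε₀ ≤ 1) (hwin : 13 * 10 ^ 14 * (F.L : ℝ) ^ 3 * ε₀ ≤ 1)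
    (U₀ : GaugeField (F.P K) 0 (Matrix.specialUnitaryGroup (Fin 2) ℂ)) (hreg : RegPr F n K ε₀ U₀)
    (hlift : ∀ cf : Site (F.P K) (K - n) → Matrix (Fin 2) (Fin 2) ℂ,
        (∀ e : PBond (F.P K) (K - n), cf e.src = ((emlIterU (K - n) (bgUnits F K U₀) e : (Matrix (Fin 2) (Fin 2) ℂ)ˣ) : Matrix (Fin 2) (Fin 2) ℂ) * cf e.tgt *
          (((emlIterU (K - n) (bgUnits F K U₀) e)⁻¹ : (Matrix (Fin 2) (Fin 2) ℂ)ˣ) : Matrix (Fin 2) (Fin 2) ℂ)) →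
        ∃ l₀ : Site (F.P K) 0 → Matrix (Fin 2) (Fin 2) ℂ,
          (∀ b : PBond (F.P K) 0, l₀ b.src = ((bgUnits F K U₀ b : (Matrix (Fin 2) (Fin 2) ℂ)ˣ) : Matrix (Fin 2) (Fin 2) ℂ) * l₀ b.tgt * (((bgUnits F K U₀ b)⁻¹ : (Matrix (Fin 2) (Fin 2) ℂ)ˣ) : Matrix (Fin 2) (Fin 2) ℂ)) ∧
          ∀ y : Site (F.P K) (K - n), l₀ (embIter (K - n) y) = cf y)
    {a a₁ : ℝ} (ha : 0 ≤ a) (ha₁ : a ≤ a₁ * (c₀ / cB) * ((F.L : ℝ) ^ (K - n)) ^ 3)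
    {γ : ℝ} (hγ : 0 < γ) (hco : ∀ v : BondL2K ℂ 3 (periodsT3 F K) c₀ W₂, γ * ‖v‖ ^ 2 ≤ RCLike.re ⟪v, laplaceA F n K h c₀ cB a (DeltaEtaSlot F n K c₀) U₀ v⟫_ℂ)
    {CK δK : ℝ} (hCK : 0 ≤ CK) (hδK : 0 < δK)
    (hkD : ∀ (b : PBond (F.P K) 0) (Z : Matrix (Fin 2) (Fin 2) ℂ) (bd : PBond (F.P K) 0),
      ‖(toL2 F K c₀).symm (DL2 F n K c₀ U₀ (DstarL2 F n K c₀ U₀ (toL2 F K c₀ (Pi.single b Z))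
          - RS F n K h c₀ cB U₀ (DstarL2 F n K c₀ U₀ (toL2 F K c₀ (Pi.single b Z))))) bd‖
        ≤ CK * ((F.L : ℝ) ^ (K - n))⁻¹ ^ 3 * Real.exp (-(δK * (Site.tdist (P := F.P K) (iterBlockOf (K - n) b.src) (iterBlockOf (K - n) bd.src) : ℝ))) * ‖Z‖)
    {r ε : ℝ} (hr : 0 < r) (hr4 : r ≤ 1 / 4) (hrδ : r ≤ δK / 2) (hε : 0 < ε) (hε8 : ε ≤ 1 / 8)
    (hεC : ε * (32 * Real.sqrt 2 * 648 + (33 / 8 : ℝ) ^ 2 * (600 * (27 / 4 : ℝ) ^ 6)) ≤ γ / 8) (hrγ : r ≤ γ * ε / 48)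
    (hrT : r * (5000 * a₁ + 27 * Real.sqrt 2 * CK * (2 * (1 + 4 / δK)) ^ 3 / min 1 (δK / 4)) ≤ γ / 16) (hαγ : 10 ^ 5 * ε₀ ≤ γ / 16)
    (hsmall : exists_curved_localGradient.choose * ((48 * ε₀) * (6 * Real.sqrt 2 * Real.sqrt 10 + 6 * Real.sqrt 2)) * Real.exp (51 / 8) ≤ 1 / 2) :
    ∀ (X : PBond (F.P K) 0 → Matrix (Fin 2) (Fin 2) ℂ) (z : Site (F.P K) (K - n)), (∀ b, X b ≠ 0 → iterBlockOf (K - n) b.src = z) →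
      ∀ s : ℝ, 0 ≤ s → (∀ b, ‖X b‖ ≤ s) →
        ∀ x : Site (F.P K) 0, ‖(toL2S F K c₀).symm (DstarL2 F n K c₀ U₀ (GT F n K h c₀ cB a (DeltaEtaSlot F n K c₀) U₀ (toL2 F K c₀ X))) x‖
          ≤ s * (3 * (Real.exp (4 / 8) * (2 * ((exists_curved_localGradient.choose * (((Real.sqrt 2 * (2 * ((Real.sqrt 2 + Real.sqrt 2 * ((50 * a₁ * Real.exp δK + CK) * (3 * Real.sqrt 2) * (Real.exp (6 * r) * (2 / γ)) * (2 * (1 + 2 / δK)) ^ 3)) * (8 * Real.exp (3 * r)) * 14 + 36 * (Real.sqrt (8 * Real.exp (3 * r) * (2 * (1 + 1 / r)) ^ 3) * (Real.exp (6 * r) * (2 / γ)))))) * Real.exp (51 / 8)) * (2 + 2 * Real.sqrt 2 * (4 * ε₀ * (3 + 2457 * norm_bgOfCfg_axialT_sub_le.choose)) + (24 * Real.sqrt 10 + 48) * (48 * ε₀) ^ 2) + (Real.sqrt 2 * ((32 * ε₀ * ((2 * ((Real.sqrt 2 + Real.sqrt 2 * ((50 * a₁ * Real.exp δK + CK) *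 (3 * Real.sqrt 2) * (Real.exp (6 * r) * (2 / γ)) * (2 * (1 + 2 / δK)) ^ 3)) * (8 * Real.exp (3 * r)) * 14 + 36 * (Real.sqrt (8 * Real.exp (3 * r) * (2 * (1 + 1 / r)) ^ 3) * (Real.exp (6 * r) * (2 / γ))))) * Real.exp (5 / 8))) + (CK * (3 * Real.sqrt 2) * (Real.exp (6 * r) * (2 / γ)) * (2 * (1 + 2 / δK)) ^ 3) + ((50 * a₁ * Real.exp δK) * (3 * Real.sqrt 2) * (Real.exp (6 * r) * (2 / γ)) * (2 * (1 + 2 / δK)) ^ 3) + 1)) * Real.exp (51 / 8)) + 2 * Real.sqrt 2 * (48 * ε₀) * ((Real.sqrt 2 * (2 * ((Real.sqrt 2 + Real.sqrt 2 * ((50 * a₁ * Real.exp δK + CK) * (3 * Real.sqrt 2) * (Real.exp (6 * r) * (2 / γ)) * (2 * (1 + 2 / δK)) ^ 3)) * (8 * Real.exp (3 * r)) * 14 + 36 * (Real.sqrt (8 * Real.exp (3 * r) * (2 * (1 + 1 / r)) ^ 3) * (Real.exp (6 * r) * (2 / γ)))))) * Real.exp (51 / 8)))))))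
            * Real.exp (-((min r (1 / 4) / 2) * (Site.tdist (P := F.P K) (iterBlockOf (K - n) x) z : ℝ))) := by
  intro X z hXz s hs hX x
  have hc₀ : 0 < c₀ := Fact.out
  have hcB : 0 < cB := Fact.out
  have hd : (F.P K).d = 3 := rfl
  have hL2 : (2 : ℝ) ≤ F.L := by exact_mod_cast F.hL.2
  have hLr : (1 : ℝ) ≤ F.L := le_trans one_le_two hL2
  have hε5 : ε₀ ≤ (10 : ℝ)⁻¹ ^ 5 := by
    have h1 : 10 ^ 12 * ε₀ ≤ 10 ^ 12 * (F.L : ℝ) ^ 3 * ε₀ := by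
      have hL3 : (1 : ℝ) ≤ (F.L : ℝ) ^ 3 := one_le_pow₀ hLr
      nlinarith [hε₀.le]
    have h2 : 10 ^ 12 * ε₀ ≤ 1 := h1.trans hWε
    rw [inv_pow]
    rw [le_inv_comm₀ hε₀ (by positivity)]
    calc (10 : ℝ) ^ 5 ≤ 10 ^ 12 := by norm_num
      _ ≤ ε₀⁻¹ := by rw [le_inv_comm₀ (by positivity) hε₀]; exact (le_div_iff₀' (by positivity)).mpr (by linarith) |>.trans (le_of_eq (one_div _))
  have hε1 : ε₀ ≤ 1 := hε5.trans (by norm_num)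
  have hεle1 : ε ≤ 1 := by linarith
  -- the four budgets ⟹ `Θ ≥ γ∕2`; the value window
  have hθ := thetaV_le_kfree hd hLr (K - n) hc₀ hcB ha ha₁ hCK hδK hr hr4 hrδ hε₀.le
  have hθ8 := hθ.trans (show r * (5000 * a₁ + 27 * Real.sqrt 2 * CK * (2 * (1 + 4 / δK)) ^ 3 / min 1 (δK / 4)) + 10 ^ 5 * ε₀ ≤ γ / 8 by linarith)
  have hεC' := (mul_le_mul_of_nonneg_left (CV_abs_le hd hε1) hε.le).trans hεC
  have hR := (rbudget_le hγ.le hr hr4 hε (by linarith) hrγ).trans (show γ / 16 ≤ γ / 8 by linarith [hγ.le])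
  have hΘ := theta_ge_half_of_budgets hγ.le hε8 hεC' hR hθ8
  have hΘpos := lt_of_lt_of_le (by positivity : (0 : ℝ) < γ / 2) hΘ
  have hS := hsmall_le_half hr4 hε₀.le hε5
  have hSV := lt_of_le_of_lt hS (by norm_num : (1 : ℝ) / 2 < 1)
  have hrμ : r < δK := by linarith
  have hCkD : 0 ≤ CK * ((F.L : ℝ) ^ (K - n))⁻¹ ^ 3 := by positivity
  have hdr : 0 < δK - r := by linarith
  have hS30 : 0 ≤ (2 * (1 + 1 / (δK - r))) ^ 3 := pow_nonneg (by have := div_nonneg zero_le_one hdr.le; linarith) 3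
  have hCg := exists_curved_localGradient.choose_spec.1
  have hC := norm_bgOfCfg_axialT_sub_le.choose_spec.1
  have e4B : (4 : ℝ) * ((Real.sqrt 2 + Real.sqrt 2 * ((50 * a₁ * Real.exp δK + CK) * (3 * Real.sqrt 2) * (Real.exp (6 * r) * (2 / γ)) * (2 * (1 + 2 / δK)) ^ 3)) * (8 * Real.exp (3 * r)) * 14 + 36 * (Real.sqrt (8 * Real.exp (3 * r) * (2 * (1 + 1 / r)) ^ 3) * (Real.exp (6 * r) * (2 / γ)))) = 2 * (2 * ((Real.sqrt 2 + Real.sqrt 2 * ((50 * a₁ * Real.exp δK + CK) * (3 * Real.sqrt 2) * (Real.exp (6 * r) * (2 / γ)) * (2 * (1 + 2 / δK)) ^ 3)) * (8 * Real.exp (3 * r)) * 14 + 36 * (Real.sqrt (8 * Real.exp (3 * r) * (2 * (1 + 1 / r)) ^ 3) * (Real.exp (6 * r) * (2 / γ))))) := by ring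
  -- numerics: every member-dependent atom of `C_D` under its K-free majorant (pure reals, before the big terms enter the context)
  have hA := twoA₂_le_kfree hd hLr (K - n) hc₀ hcB ha ha₁ hCK hδK hr hr4 hrδ hγ hΘ hε₀.le hε5
  have hAV := le_of_mul_le_mul_left (hA.trans_eq e4B) (two_pos : (0 : ℝ) < 2)
  obtain ⟨hWD, hWQ⟩ := words_le_kfree hd hLr (K - n) hc₀ hcB ha ha₁ hCK hδK hr hrδ hγ hΘ
  -- the fed letters (A2i's knit)
  have hp : PosOnto F n K h c₀ cB a (DeltaEtaSlot F n K c₀) U₀ :=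
    ⟨fun v hv => lt_of_lt_of_le (mul_pos hγ (pow_pos (norm_pos_iff.mpr hv) 2)) (hco v), surjective_Qk_of_regPr F h hnK c₀ cB hreg hwin⟩
  have hQ : ∀ v : BondL2K ℂ 3 (periodsT3 F K) c₀ W₂, ‖Qk F n K h c₀ cB U₀ v‖ ≤ (6 * Real.sqrt (cB / c₀) * Real.sqrt (((F.L : ℝ) ^ (K - n))⁻¹ ^ 3)) * ‖v‖ :=
    fun v => norm_Qk_le_of_regPr F h c₀ cB hε₀ hε10 hWε U₀ hreg v
  have hVconj := hVconj_phaseClass_of_letters F h c₀ cB (a := a) hε₀ hε10 hWε U₀ hreg ha hr.le hrμ hCkD hkD hQ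
  have hVlow := hVlow_abs_of_lift F h c₀ cB (a := a) hnK hε₀ hWε U₀ hreg ha hlift
  have hkQ := hkQ_of_regPr F h c₀ cB hε₀ hε10 hWε U₀ hreg ha (le_of_lt (hr.trans hrμ))
  -- the decayed VALUE row (px16 §3), fed
  have hval := fun bd : PBond (F.P K) 0 =>
    norm_symm_GT_apply_le_of_blockSupport (h := h) (cB := cB) (a := a) hnK.le hε₀.le U₀ hreg hp hr hε hεle1 hco hVlow hVconj hΘpos hCkD
      (by positivity) hrμ hkD hkQ hSV X z hXz hs hX bd
  -- the gradient margin at `κ₁ ≤ ⅛`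
  have hsmallκ : exists_curved_localGradient.choose * ((48 * ε₀) * (6 * Real.sqrt 2 * Real.sqrt 10 + 6 * Real.sqrt 2)) * Real.exp (51 * (min r (1 / 4) / 2)) ≤ 1 / 2 :=
    (mul_le_mul_of_nonneg_left (exp_mul_kappa_le (r := r) (by norm_num : (0 : ℝ) ≤ 51))
      (mul_nonneg exists_curved_localGradient.choose_spec.1 (by positivity))).trans hsmall
  -- (dκ) at the member with every letter fed
  have main := norm_symm_DstarL2_GT_le_of_blockSupport_allMembers F c₀ U₀ (h := h) (cB := cB) (a := a) hnK.le hε₀ hε1 hreg hp hr hε hεle1 hco hVlow hVconj hΘpos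
    hCkD (by positivity) hrμ hkD hkQ X z hXz hs hX hval hsmallκ x
  rcases hs.eq_or_lt with h0 | hpos
  · -- `s = 0`: both sides vanish
    refine main.trans (le_of_eq ?_)
    rw [← h0]; simp only [zero_mul]
  · -- `0 < s`: the sign of `A_V` is read off the value row at one bond, then monotonicity
    have hb := hval ⟨x, ⟨0, by rw [T3Family.P_d]; norm_num⟩⟩
    have hAV0 := (mul_nonneg_iff_of_pos_left hpos).mp ((mul_nonneg_iff_of_pos_right (Real.exp_pos _)).mp ((norm_nonneg _).trans hb))
    have mono := CD_mono (Cg := exists_curved_localGradient.choose) (ε₀ := ε₀)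
      (cε := (2 + 2 * Real.sqrt 2 * (4 * ε₀ * (3 + 2457 * norm_bgOfCfg_axialT_sub_le.choose)) + (24 * Real.sqrt 10 + 48) * (48 * ε₀) ^ 2))
      (lAV := hAV) (lWD := hWD) (lWQ := hWQ)
      (l4 := exp_mul_kappa_le (r := r) (by norm_num : (0 : ℝ) ≤ 4))
      (l51 := exp_mul_kappa_le (r := r) (by norm_num : (0 : ℝ) ≤ 51))
      (l5 := exp_mul_kappa_le (r := r) (by norm_num : (0 : ℝ) ≤ 5))
      hCg (by positivity) hε₀.le (Real.exp_pos _).le hAV0 (Real.exp_pos _).le (Real.exp_pos _).le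
      (by exact mul_nonneg (mul_nonneg (mul_nonneg hCkD (Real.sqrt_nonneg _)) (div_nonneg (by positivity) hΘpos.le)) hS30)
      (by exact mul_nonneg (mul_nonneg (by positivity) (div_nonneg (by positivity) hΘpos.le)) hS30)
    exact main.trans (mul_le_mul_of_nonneg_right (mul_le_mul_of_nonneg_left mono hs) (Real.exp_pos _).le)

end KFree

end Summit.QuantumFields.YangMills.Theorems.Prop7OneFormGreenBlockDivergenceAllMembers

end
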